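import Summits.CriticalPhenomena.PercolationContinuityZ3.Theorems.PercNearOneGluingNoHeavyLowerTailKnQuestion8PocketPieces
import HarnessLib

/-!
# KN Question 8 at three relays, PCOV by one-edge Bernstein induction — the marker covariance `Q2 ≥ 0` without weak set (proved)

Support file (`--supports stmt-CriticalPhenomena-4575`, closed), prover `prim-hp-7` (gen 37).  No definitions, no named
facts, no sorries; standard axioms.  Memo `prim-hp-7/FROM-prim-hp-7-g37-PCOV-BERNSTEIN.md` §1 (Q2), §9(b).

Setting: `μ = prodBernoulli w`; owner `x`, second strong relay `y`, and a set `T` of vertices to be avoided by BOTH (for the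
pocket covariance comparison PCOV: `T = {o}` — the observer's pocket avoids `x` and `y` — possibly enlarged by weak vertices);
`D = {{x,y} ↮ T}`; `F` a monotone function of the vertex cluster `C_x`.  THEOREM (`PcovBern.markerCov_nonneg`):

  `(∫_D F(C_x) dμ) · μ(D ∩ {x ↔ y}) ≤ μ(D) · ∫_{D ∩ {x↔y}} F(C_x) dμ`,

i.e. `Cov(F(C_x), 1{y ∈ C_x} | D) ≥ 0`: given that neither strong relay is joined to the pocket / weak vertices, the marker
`y` is positively correlated with every increasing function of the owner's cluster.  This is the quantity `Q2 ≥ 0` of the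
memo (the `z`-free case `Q2_∅`, used in the leaf case of the `z`-edge induction: `F_{τ_B}(A,A) = P_A/c_A + (τ_A − τ_B)·Q2_A ≥ 0`).
Proof: van den Berg–Häggström–Kahn Thm 2.1 at `q = 1` for the sets `S = {x,y}`, `T`
(`BHK2006_setClusterConditionalPositiveAssociation`): `F(C_x)` and `1{x↔y}` are increasing functions of the edge cluster of
`S` (`KNSep.reachable_iff_cluster`).  Census (prim-hp-7 gen 37): 0 / 4 718 (all up-set indicators, n ≤ 6, with and without a
weak relay).  Not in print in this form.
[cite: VandenbergHaggstromKahn2005, Thm. 2.1 (p. 9), Remark 1 after Thm. 1.2 (p. 5), Thm. 1.3 (p. 6)]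
[cite: KozmaNitzan2024, Question 8 (§5.5 p. 36)]
-/

namespace Summit.CriticalPhenomena.PercolationContinuityZ3.Theorems

open MeasureTheory Set Literature.Probability.LatticeModels Literature.Probability.Percolation
open scoped Classical
open KNPreFKG

noncomputable section

namespace PcovBern

variable {V : Type*} [Fintype V]

/-- **Marker covariance is nonnegative given avoidance (`Q2 ≥ 0`).**  With `D = {ω | ∀ s ∈ {x,y}, ∀ t ∈ T, ¬ s ↔ t}` and
`F` monotone on vertex sets: `(∫_D F(C_x)) · μ(D ∩ {x↔y}) ≤ μ(D) · ∫_{D ∩ {x↔y}} F(C_x)`.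
[cite: VandenbergHaggstromKahn2005, Thm. 2.1 (p. 9), Remark 1 after Thm. 1.2 (p. 5)] -/
theorem markerCov_nonneg (w : Sym2 V → unitInterval) (x y : V) (T : Set V) (F : Set V → ℝ)
    (hF : ∀ S S' : Set V, S ⊆ S' → F S ≤ F S') :
    (∫ ω in {ω : BondConfig V | ∀ s ∈ ({x, y} : Set V), ∀ t ∈ T, ¬ (openGraph ω).Reachable s t},
        F (openCluster ω x) ∂(prodBernoulli w)) *
      (prodBernoulli w).real ({ω : BondConfig V | ∀ s ∈ ({x, y} : Set V), ∀ t ∈ T, ¬ (openGraph ω).Reachable s t} ∩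
        openConn x y) ≤
    (prodBernoulli w).real {ω : BondConfig V | ∀ s ∈ ({x, y} : Set V), ∀ t ∈ T, ¬ (openGraph ω).Reachable s t} *
      ∫ ω in {ω : BondConfig V | ∀ s ∈ ({x, y} : Set V), ∀ t ∈ T, ¬ (openGraph ω).Reachable s t} ∩ openConn x y,
        F (openCluster ω x) ∂(prodBernoulli w) := by
  classical
  set μ := prodBernoulli w with hμ
  set S : Set V := {x, y} with hS
  set D : Set (BondConfig V) := {ω : BondConfig V | ∀ s ∈ S, ∀ t ∈ T, ¬ (openGraph ω).Reachable s t} with hD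
  set J : Set (BondConfig V) := openConn x y with hJ
  set Fe : Set (Sym2 V) → ℝ := fun C => F (openCluster C x) with hFe
  set Ge : Set (Sym2 V) → ℝ := fun C => if y ∈ openCluster C x then (1 : ℝ) else 0 with hGe
  have hFe_mono : Monotone Fe := fun C C' hCC' => hF _ _ (openCluster_mono hCC' x)
  have hGe_mono : Monotone Ge := by
    intro C C' hCC'
    simp only [hGe]
    by_cases h : y ∈ openCluster C x
    · rw [if_pos h, if_pos (openCluster_mono hCC' x h)]
    · rw [if_neg h]; split_ifs <;> norm_num
  have hxS : x ∈ S := by simp [hS]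
  have hclx : ∀ ω : BondConfig V, openCluster (⋃ s ∈ S, openEdgeCluster ω s) x = openCluster ω x := by
    intro ω; ext a; exact (KNSep.reachable_iff_cluster ω S hxS a).symm
  have hFe_eq : ∀ ω : BondConfig V, Fe (⋃ s ∈ S, openEdgeCluster ω s) = F (openCluster ω x) := by
    intro ω; simp only [hFe, hclx ω]
  have hGe_eq : ∀ ω : BondConfig V, Ge (⋃ s ∈ S, openEdgeCluster ω s) = J.indicator 1 ω := by
    intro ω
    simp only [hGe, hclx ω]
    by_cases h : y ∈ openCluster ω x
    · rw [if_pos h, indicator_of_mem (show ω ∈ J from h)]; simp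
    · rw [if_neg h, indicator_of_notMem (show ω ∉ J from h)]
  have key := BHK2006_setClusterConditionalPositiveAssociation w S T Fe Ge hFe_mono hGe_mono
  have eF : ∫ ω in D, Fe (⋃ s ∈ S, openEdgeCluster ω s) ∂μ = ∫ ω in D, F (openCluster ω x) ∂μ := by
    simp_rw [hFe_eq]
  have eG : ∫ ω in D, Ge (⋃ s ∈ S, openEdgeCluster ω s) ∂μ = μ.real (D ∩ J) := by
    simp_rw [hGe_eq]; rw [setIntegral_indicator_one_eq μ D J]
  have eFG : ∫ ω in D, Fe (⋃ s ∈ S, openEdgeCluster ω s) * Ge (⋃ s ∈ S, openEdgeCluster ω s) ∂μ =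
      ∫ ω in D ∩ J, F (openCluster ω x) ∂μ := by
    simp_rw [hFe_eq, hGe_eq]
    rw [setIntegral_mul_indicator_one μ D J (fun ω => F (openCluster ω x))]
  rw [eF, eG, eFG] at key
  simpa only [hD, hJ] using key

end PcovBern

end

end Summit.CriticalPhenomena.PercolationContinuityZ3.Theorems
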